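import Summits.BirchSwinnertonDyer.Rank1Residual.Additive.KatoDescentIntegralH1TorsionFree
import Literature.NumberTheory.EllipticCurves.IwasawaEulerCharDivisibilityProofs
import Literature.NumberTheory.EllipticCurves.Kato2004.FineSelmerDualTorsionOfEulerSystemBoundProofs
import Literature.NumberTheory.EllipticCurves.Kato2004.IwasawaH2DescentRankOne
import Literature.NumberTheory.EllipticCurves.KatoFineSelmerFiniteProofs
import Literature.NumberTheory.EllipticCurves.KatoFineSelmerDualUniquenessProofs
import HarnessLib

set_option autoImplicit false

/-!
# J-ELIMINATION: on a Kato descent package the order of `(J.H2)_Γ` is determined by the PINNED data —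
# `#(J.H2)_Γ · #X₀[T] = #desc(I) · #(X₀)_Γ` (descent cokernel of `𝐇¹_Γ`, Γ-Euler characteristic of the dual fine
# Selmer group) — and COUNT-EC⁰ ⟸ {GZK, Thm. 12.4} + a J-FREE display COUNT-FINE⁰; brick (c), step 1, of the
# COUNT-EC⁰ lane (seat `bsd-cm-prr-ty1` g10, cell `bsd-cm`; theorems only: no definition, no named fact, no instance,
# no `sorry`)

Part 17 of the seat's kernel cut of stub 3 `stub_rankOneCountReadingKato` of the Kato–Perrin-Riou skeletons v4 (cruxes
stmt-BirchSwinnertonDyer-19945 / -19223; = cell bsd-potss's held input 27322). After Parts 15–16 (bricks (a′), (b)) the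
display COUNT-EC⁰ («`v_p #(J.H2)_Γ + v₀ = v_p #Ш[p^∞] + v_p Tam + 2·v_p log_ω P`», Part 11) is the last displayed input
of card option (b′) besides PR-INV. Its left-hand side is the order of the coinvariants of the ABSTRACT `Λ`-module `J.H2`
of a descent package `J : Kato2004.IwasawaH2Data W p κ γ I` — the tree has no construction of Kato's `𝐇²(T_pW)`; the
package pins `J.H2` only through Kato's exact sequence (14.14.1) `0 → 𝐇¹_Γ/T → A → 𝐇²[T] → 0` (fields `ι`, `π`; tree
`IwasawaH2Data.descentCokernelEquiv : desc(I) ≃ J.H2[T]`) and, on the rows, through the (H2ᶜ) pin «`ℓ_𝔮(J.H2) = ℓ_𝔮(X₀)`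
at every height-one `𝔮`» against the dual fine Selmer group `X₀ = Y.X` of key `γ⁻¹` (`W.FineSelmerDualData κ γ⁻¹`).
THIS FILE shows that these two pins already DETERMINE `#(J.H2)_Γ`, and rewrites the display accordingly:

* §1 `module_finite_fineSelmerDualData_inv` — **the dual fine Selmer datum of the contragredient key `γ⁻¹` is finitely
  generated over `Λ`** (any number field; `κ γ = 1`, so `γ⁻¹` is not a normalised generator and the tree's
  `FineSelmerDualData.module_finite` does not apply verbatim): Nakayama for Pontryagin duals with the any-key nilpotence
  `isLocNil_conjFineSelmerInfty_sub_one'`, the finite set `{s ∈ Sel₀ : p s = 0, conj_{γ⁻¹} s = s}` being the one for `γ`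
  (`conj_γ ∘ conj_{γ⁻¹} = id`, `conjH1_mul_holds` / `conjH1_one_holds`; `finite_setOf_fineSelmerInfty_pTorsion_conjH1_eq`).
* §2 **`natCard_coinvariants_H2_mul_eq_of_lengthAt_eq`** — for `J` with the lengths pin against a finitely generated `Y`
  and `(J.H2)_Γ` finite: `Y.X` is `Λ`-torsion (`isTorsion_of_lengthAt_primeT_ne_top`), `X₀[T]`, `(X₀)_Γ` are finite, and
  **`#(J.H2)_Γ · #X₀[T] = #desc(I) · #(X₀)_Γ`** — the Γ-Euler-characteristic divisibility
  `#(M/TM)·#N[T] ∣ #M[T]·#(N/TN)` for `ℓ_𝔮(M) ≤ ℓ_𝔮(N)` (tree `IwasawaAlgebra.natCard_coinvariants_mul_dvd_of_lengthAt_le`,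
  Greenberg Lemma 4.2 / Kato Lemma 14.15) applied in BOTH directions, and `#J.H2[T] = #desc(I)` by (14.14.1);
  `padicValNat_coinvariants_H2_add_eq_of_lengthAt_eq` (valuation form).
* §3 **`countEC₀_of_gzk_of_thm12_4_of_countFine₀`** — COUNT-EC⁰ ⟸ {GZK, `Kato2004.thm12_4`} + COUNT-FINE⁰, the J-FREE
  display «`v_p #desc(I) + v_p #(X₀)_Γ − v_p #X₀[T] + v₀ = v_p #Ш[p^∞] + v_p Tam + 2·v_p log_ω P`» over the pinned
  `I : IwasawaH1Data`, a dual fine Selmer datum `Y` of key `γ⁻¹`, a generator `P`, and a Kummer-log functional `φ` with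
  `φ(A) = p^{v₀}ℤ_p`, asked only with `rank W(ℚ) = 1`, `𝐇¹_Γ` f.g. torsion-free of rank one, `desc(I)`, `(X₀)_Γ`, `X₀[T]`
  finite and `Y.X` f.g. among the hypotheses (all DISCHARGED in the reduction: GZK, Thm. 12.4 (2),
  `finite_coinvariants_H2_of_iwasawaH2Data`, `nonempty_fineSelmerDualData'`, §1, §2); then
  `count_of_gzk_of_thm12_4_of_countFine₀ : <hCount verbatim>` and
  **`rankOneCountReading_contra_of_gzk_of_thm12_4_of_countFine₀`** = stub 3 (verbatim type in both v4 skeletons) from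
  {GZK, `IsNewformOf.level_eq_conductorNorm`, `Kato2004.thm12_4`} + {PR-INV (6), COUNT-FINE⁰}.

WHY (potss memo KMC-DESCENT-MEMO §4): for Kato's genuine `𝐇²`, `#𝐇²_Γ = #H²(ℤ[1/p], T_pW)` ((14.14.2)) is computed by the
Poitou–Tate count (R1-b)–(R1-d); in the tree's currency the same number is `#desc(I) · #(X₀)_Γ / #X₀[T]`, so the two
remaining inputs of COUNT are now NAMED classical objects: (c2) the Γ-Euler characteristic of the fine Selmer group
`Sel₀(W/ℚ_∞)` in rank one with trivial fine Mordell–Weil group (in print: Wuthrich, J. Algebraic Geom. 16, «Iwasawa theory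
of the fine Selmer group»), and (c3) the universal-norm index `#desc(I) = [H¹(ℤ[1/p], T_pW) : proj₀ 𝐇¹_Γ]` (Perrin-Riou,
Invent. Math. 109 (1992); Kato (14.14.2) with (14.9.3)). Nothing of (c2)/(c3) is proved or cited as a fact here.

HONEST LABEL: theorems only; no stub or item is closed; nothing is registered; nothing is asserted on 19945 / 19223;
Kato's Main Conjecture and Perrin-Riou's conjecture are not touched; BSD is not proved for any curve.

References: [Kato2004Asterisque] §12.2 (12.2.1) (p. 220), Thm. 12.4 (p. 221), §13.8 (p. 228), §14.9 (14.9.3) (p. 240),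
§14.14 (14.14.1)–(14.14.2) (p. 243), Lemma 14.15 and Prop. 14.16 (p. 244); [GreenbergLNM1716] §1 (p. 60), §4 Lemma 4.2
(p. 102); [CoatesSujatha2005] §3; [Washington1997] §13.2; [SerreGaloisCohomology1997] I.§2.6 (b); [Wuthrich2007JAG] and
[PerrinRiou1992] (orientation only, no statement of theirs is used); [PerrinRiou1993AIF] §3.3.
-/

noncomputable section

open scoped Classical NumberField

open WeierstrassCurve Field IsDedekindDomain NumberField CategoryTheory Literature.NumberTheory.EllipticCurves
  Literature.NumberTheory.EllipticCurves.Kato2004 Literature.NumberTheory.EllipticCurves.IwasawaAlgebra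
  Literature.NumberTheory.EllipticCurves.Kato2004.EulerSystemValues Literature.NumberTheory.GaloisRepresentations
  Literature.NumberTheory.EllipticCurves.ModularForms Literature.NumberTheory.EllipticCurves.Rank1Residual
open Summit.BirchSwinnertonDyer.BirchSwinnertonDyer.Theorems.CongruentShaFreeCutKatoDescentDatumOfH2

universe u

namespace Summit.BirchSwinnertonDyer.Rank1Residual.Additive.LocPKummer

/-! ## §1 The dual fine Selmer datum of key `γ⁻¹` is finitely generated over `Λ` -/

section KeyInv

variable {K : Type u} [Field K] [NumberField K] (W : WeierstrassCurve K) [W.IsElliptic] {p : ℕ} [Fact p.Prime]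
  {κ : ZpExtension K p} {γ : absoluteGaloisGroup K}

/-- **`X₀(E/K_∞)` keyed at `γ⁻¹` is finitely generated over `Λ`** (`γ` the normalised topological generator,
`κ γ = 1`; the contragredient key `γ⁻¹` of the print-exact Kato packages is NOT normalised, `κ γ⁻¹ = −1`, so the
tree's `FineSelmerDualData.module_finite` does not apply verbatim): Nakayama for Pontryagin duals
(`IwasawaDual.IsDualPair.module_finite`) with the local nilpotence of `conj_{γ⁻¹} − 1` for ANY key
(`isLocNil_conjFineSelmerInfty_sub_one'`) and the finiteness of `{s ∈ Sel₀ | p s = 0, conj_{γ⁻¹} s = s}` — the SAME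
set as for `γ` (`conj_γ ∘ conj_{γ⁻¹} = conj_1 = id`, `conjH1_mul_holds`, `conjH1_one_holds`), finite by
`finite_setOf_fineSelmerInfty_pTorsion_conjH1_eq`. [cite: GreenbergLNM1716, §1 p. 60 (after Conj. 1.3)]
[cite: CoatesSujatha2005, §3] [cite: SerreGaloisCohomology1997, I.§2.6 (b)] -/
theorem module_finite_fineSelmerDualData_inv (hγ : κ.IsTopGenerator γ) (Y : W.FineSelmerDualData κ γ⁻¹) :
    Module.Finite (IwasawaAlgebra p) Y.X := by
  have hpair : IwasawaDual.IsDualPair p (W.conjFineSelmerInfty κ γ⁻¹ - 1) Y.toDual :=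
    { bijective := Y.bijective
      T_smul := fun x s ↦ by
        rw [Y.toDual_T_smul, IwasawaDual.End_sub_apply, AddMonoid.End.one_apply, map_sub]
        rfl
      C_smul := fun c x s k hk ↦ Y.toDual_C_smul c x s k hk
      locNil := W.isLocNil_conjFineSelmerInfty_sub_one' κ γ⁻¹ }
  refine hpair.module_finite ?_
  refine (W.finite_setOf_fineSelmerInfty_pTorsion_conjH1_eq κ hγ).subset fun s hs ↦ ?_
  obtain ⟨hs1, hs2⟩ := hs
  rw [pow_one] at hs1 hs2
  refine ⟨hs1, ?_⟩
  rw [IwasawaDual.End_sub_apply, AddMonoid.End.one_apply, sub_eq_zero] at hs2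
  -- `conj_{γ⁻¹} s = s`; apply `conj_γ`
  have h2 : W.conjH1 p κ.kerSubgroup γ⁻¹ (s : W.subgroupH1 p κ.kerSubgroup) = s :=
    congrArg (fun z : W.fineSelmerInfty κ ↦ (z : W.subgroupH1 p κ.kerSubgroup)) hs2
  have h3 := congrArg (W.conjH1 p κ.kerSubgroup γ) h2
  rw [← AddMonoidHom.comp_apply, ← W.conjH1_mul_holds p κ.kerSubgroup γ γ⁻¹, mul_inv_cancel,
    W.conjH1_one_holds p κ.kerSubgroup, AddMonoidHom.id_apply] at h3
  exact h3.symm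

end KeyInv

/-! ## §2 J-elimination: `#(J.H2)_Γ · #X₀[T] = #desc(I) · #(X₀)_Γ` on a package with the (H2ᶜ) pin -/

section JElim

variable (W : WeierstrassCurve ℚ) [W.IsElliptic] (p : ℕ) [Fact p.Prime] [ContinuousSMul ℤ_[p] (W.tateModule p)]
  {κ : ZpExtension ℚ p} {γ : absoluteGaloisGroup ℚ}

/-- **J-ELIMINATION OF `#(J.H2)_Γ`.** On a descent package `J : IwasawaH2Data W p κ γ I` whose `J.H2` has the local
lengths of a dual fine Selmer datum `Y` (key `γ'`, `Y.X` finitely generated) at every height-one prime (the (H2ᶜ) pin),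
with `(J.H2)_Γ = J.H2/T` finite: `Y.X` is `Λ`-torsion, `X₀[T]` and `(X₀)_Γ = X₀/T` are finite, and
**`#(J.H2/T) · #X₀[T] = #desc(I) · #(X₀/T)`** where `desc(I) = H¹(ℤ[1/p], T_pW) / proj₀(𝐇¹_Γ)` is Kato's descent
cokernel of the PINNED `I` (`IwasawaH1Data.descentCokernel`, `≃ J.H2[T]` by (14.14.1), `descentCokernelEquiv`). Proof:
the Γ-Euler-characteristic divisibility `#(M/TM)·#N[T] ∣ #M[T]·#(N/TN)` for `ℓ_𝔮(M) ≤ ℓ_𝔮(N)`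
(`natCard_coinvariants_mul_dvd_of_lengthAt_le`, Greenberg Lemma 4.2 / Kato Lemma 14.15) in BOTH directions.
Consequently the abstract `J.H2` disappears from the count: `#(J.H2)_Γ` is determined by the pinned `I` and the fine
Selmer group over `ℚ_∞`. [cite: Kato2004Asterisque, §14.14 (14.14.1) (p. 243) and Lemma 14.15 (p. 244)]
[cite: GreenbergLNM1716, §4 Lemma 4.2 (p. 102)] -/
theorem natCard_coinvariants_H2_mul_eq_of_lengthAt_eq {I : IwasawaH1Data W p κ γ} (J : IwasawaH2Data W p κ γ I)
    {γ' : absoluteGaloisGroup ℚ} (Y : W.FineSelmerDualData κ γ') [Module.Finite (IwasawaAlgebra p) Y.X]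
    (hpin : ∀ 𝔮 : PrimeSpectrum (IwasawaAlgebra p), 𝔮.asIdeal.height = 1 →
      Module.lengthAt (IwasawaAlgebra p) J.H2 𝔮 = Module.lengthAt (IwasawaAlgebra p) Y.X 𝔮)
    (hfin : Finite (coinvariants p J.H2)) :
    Finite (invariants p Y.X) ∧ Finite (coinvariants p Y.X) ∧
      Nat.card (coinvariants p J.H2) * Nat.card (invariants p Y.X) =
        Nat.card I.descentCokernel * Nat.card (coinvariants p Y.X) := by
  haveI : Module.Finite (IwasawaAlgebra p) J.H2 := J.finite_H2
  have hH2 : Module.IsTorsion (IwasawaAlgebra p) J.H2 := J.isTorsion_H2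
  have hX : Module.IsTorsion (IwasawaAlgebra p) Y.X :=
    isTorsion_of_lengthAt_primeT_ne_top Y.X (by
      rw [← hpin (primeT p) (height_primeT p)]
      exact lengthAt_ne_top_of_isTorsion J.H2 hH2 (primeT p) (height_primeT p).le)
  obtain ⟨hXinv, hXco, -⟩ := finite_coinvariants_of_lengthAt_le hX hH2 (fun 𝔮 h𝔮 ↦ (hpin 𝔮 h𝔮).ge) hfin
  have h1 := natCard_coinvariants_mul_dvd_of_lengthAt_le hH2 hX (fun 𝔮 h𝔮 ↦ (hpin 𝔮 h𝔮).le) hXco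
  have h2 := natCard_coinvariants_mul_dvd_of_lengthAt_le hX hH2 (fun 𝔮 h𝔮 ↦ (hpin 𝔮 h𝔮).ge) hfin
  refine ⟨hXinv, hXco, ?_⟩
  rw [Nat.card_congr J.descentCokernelEquiv.toEquiv]
  exact Nat.dvd_antisymm h1 (by rw [mul_comm (Nat.card (invariants p J.H2)), mul_comm (Nat.card (coinvariants p J.H2))]; exact h2)

/-- **The same in valuations**: `v_p #(J.H2/T) + v_p #X₀[T] = v_p #desc(I) + v_p #(X₀/T)` (all four finite and
non-zero). [cite: Kato2004Asterisque, §14.14 (14.14.1) and Lemma 14.15 (pp. 243–244)] [cite: GreenbergLNM1716, §4 Lemma 4.2] -/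
theorem padicValNat_coinvariants_H2_add_eq_of_lengthAt_eq {I : IwasawaH1Data W p κ γ} (J : IwasawaH2Data W p κ γ I)
    {γ' : absoluteGaloisGroup ℚ} (Y : W.FineSelmerDualData κ γ') [Module.Finite (IwasawaAlgebra p) Y.X]
    (hpin : ∀ 𝔮 : PrimeSpectrum (IwasawaAlgebra p), 𝔮.asIdeal.height = 1 →
      Module.lengthAt (IwasawaAlgebra p) J.H2 𝔮 = Module.lengthAt (IwasawaAlgebra p) Y.X 𝔮)
    (hfin : Finite (coinvariants p J.H2)) :
    padicValNat p (Nat.card (coinvariants p J.H2)) + padicValNat p (Nat.card (invariants p Y.X)) =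
      padicValNat p (Nat.card I.descentCokernel) + padicValNat p (Nat.card (coinvariants p Y.X)) := by
  obtain ⟨hXinv, hXco, h⟩ := natCard_coinvariants_H2_mul_eq_of_lengthAt_eq W p J Y hpin hfin
  haveI := hfin
  haveI := hXinv
  haveI := hXco
  haveI : Finite I.descentCokernel := J.finite_descentCokernel_iff_finite_coinvariants_H2.mpr hfin
  have hv := congrArg (padicValNat p) h
  rwa [padicValNat.mul Nat.card_pos.ne' Nat.card_pos.ne', padicValNat.mul Nat.card_pos.ne' Nat.card_pos.ne'] at hv

end JElim

/-! ## §3 COUNT-EC⁰ ⟸ {GZK, `Kato2004.thm12_4`} + the J-FREE display COUNT-FINE⁰; COUNT and stub 3 over COUNT-FINE⁰ -/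

section CountFine

/-- **COUNT-EC⁰ ⟸ {GZK, `Kato2004.thm12_4`} + COUNT-FINE⁰.** COUNT-FINE⁰ is the display COUNT-EC⁰ with the abstract
module `(J.H2)_Γ` of the package REPLACED by the two concrete quantities of §2: Kato's descent cokernel
`desc(I) = H¹(ℤ[1/p], T_pW) / proj₀(𝐇¹_Γ)` of the pinned `I` and the Γ-Euler characteristic of the dual fine Selmer
group `X₀ = Y.X` (key `γ⁻¹`): «`v_p #desc(I) + v_p #(X₀/T) − v_p #X₀[T] + v₀ = v_p #Ш[p^∞] + v_p Tam + 2·v_p log_ω P`»,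
asked only on the rows where `desc(I)` and `X₀/T` are finite and `rank W(ℚ) = 1`. On a package with the (H2ᶜ) pin,
GZK (rank one) and Thm. 12.4 (2) (`𝐇¹_Γ` f.g. torsion-free of rank one) make `(J.H2)_Γ` finite
(`finite_coinvariants_H2_of_iwasawaH2Data`), a dual fine Selmer datum of key `γ⁻¹` exists (`nonempty_fineSelmerDualData'`)
and is finitely generated (§1), and §2 converts the left-hand sides. Conditional reduction; nothing asserted.
[cite: Kato2004Asterisque, §14.14 (14.14.1) (p. 243), Lemma 14.15 (p. 244), Thm. 12.4 (p. 221)]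
[cite: GreenbergLNM1716, §4 Lemma 4.2 (p. 102)] [cite: Darmon2004, Thm. 3.22] -/
theorem countEC₀_of_gzk_of_thm12_4_of_countFine₀
    (hGZK : rank_eq_analyticRank_of_analyticRank_le_one) (h12 : Kato2004.thm12_4)
    (hFINE₀ : ∀ (W : WeierstrassCurve ℚ) [W.IsElliptic] [W.IsGloballyMinimal] (p : ℕ) [Fact p.Prime],
      letI : ContinuousSMul ℤ_[p] (W.tateModule p) := TateModule.continuousSMul_padicInt
      ∀ (κ : ZpExtension ℚ p) (γ : absoluteGaloisGroup ℚ), κ.IsCyclotomic → κ.IsTopGenerator γ →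
        ∀ (I : IwasawaH1Data W p κ γ) (Y : W.FineSelmerDualData κ γ⁻¹) (P : W.toAffine.Point)
          (φ : integralH1 (tateRep W p) p (κ.layerSubgroup 0) →ₗ[ℤ_[p]] ℚ_[p]) (v₀ : ℤ),
          W.analyticRank = 1 → W.mordellWeilRank = 1 → p ≠ 2 → Addv W p → 0 ≤ padicValRat p W.j →
          ¬ p ∣ W.torsionOrder → Finite W.sha →
          Module.Finite (IwasawaAlgebra p) I.H → Module.IsTorsionFree (IwasawaAlgebra p) I.H →
          Module.rank (IwasawaAlgebra p) I.H = 1 →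
          Finite I.descentCokernel → Module.Finite (IwasawaAlgebra p) Y.X → Finite (coinvariants p Y.X) →
          Finite (invariants p Y.X) →
          (∀ Q : W.toAffine.Point, ∃ n : ℤ, IsOfFinAddOrder (Q - n • P)) →
          (∀ x : integralH1 (tateRep W p) p (κ.layerSubgroup 0),
            HasLocPKummerLog W p (layerZeroToTop W p κ (x : H1 (tateRep W p) (κ.layerSubgroup 0))) (φ x)) →
          LinearMap.range φ = Submodule.span ℤ_[p] {((p : ℚ_[p]) ^ v₀)} →
          (padicValNat p (Nat.card I.descentCokernel) : ℤ) + padicValNat p (Nat.card (coinvariants p Y.X)) -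
              padicValNat p (Nat.card (invariants p Y.X)) + v₀ =
            padicValNat p (Nat.card (AddCommGroup.primaryComponent W.sha p)) + padicValNat p W.tamagawaProduct +
              2 * (padicLogLocal W p
                (WeierstrassCurve.Affine.Point.map (W' := W.toAffine) (S := ℚ) (Algebra.ofId ℚ ℚ_[p]) P)).valuation) :
    ∀ (W : WeierstrassCurve ℚ) [W.IsElliptic] [W.IsGloballyMinimal] (p : ℕ) [Fact p.Prime],
      letI : ContinuousSMul ℤ_[p] (W.tateModule p) := TateModule.continuousSMul_padicInt
      ∀ (κ : ZpExtension ℚ p) (γ : absoluteGaloisGroup ℚ), κ.IsCyclotomic → κ.IsTopGenerator γ →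
        ∀ (I : IwasawaH1Data W p κ γ) (J : IwasawaH2Data W p κ γ I) (P : W.toAffine.Point)
          (φ : integralH1 (tateRep W p) p (κ.layerSubgroup 0) →ₗ[ℤ_[p]] ℚ_[p]) (v₀ : ℤ),
          W.analyticRank = 1 → p ≠ 2 → Addv W p → 0 ≤ padicValRat p W.j → ¬ p ∣ W.torsionOrder →
          Finite W.sha →
          (∀ (Y : W.FineSelmerDualData κ γ⁻¹) (𝔮 : PrimeSpectrum (IwasawaAlgebra p)), 𝔮.asIdeal.height = 1 →
            Module.lengthAt (IwasawaAlgebra p) J.H2 𝔮 = Module.lengthAt (IwasawaAlgebra p) Y.X 𝔮) →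
          (∀ Q : W.toAffine.Point, ∃ n : ℤ, IsOfFinAddOrder (Q - n • P)) →
          (∀ x : integralH1 (tateRep W p) p (κ.layerSubgroup 0),
            HasLocPKummerLog W p (layerZeroToTop W p κ (x : H1 (tateRep W p) (κ.layerSubgroup 0))) (φ x)) →
          LinearMap.range φ = Submodule.span ℤ_[p] {((p : ℚ_[p]) ^ v₀)} →
          (padicValNat p (Nat.card (coinvariants p J.H2)) : ℤ) + v₀ =
            padicValNat p (Nat.card (AddCommGroup.primaryComponent W.sha p)) + padicValNat p W.tamagawaProduct +
              2 * (padicLogLocal W p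
                (WeierstrassCurve.Affine.Point.map (W' := W.toAffine) (S := ℚ) (Algebra.ofId ℚ ℚ_[p]) P)).valuation := by
  intro W _ _ p _
  letI : ContinuousSMul ℤ_[p] (W.tateModule p) := TateModule.continuousSMul_padicInt
  intro κ γ hκ hγ I J P φ v₀ hr hp2 hadd hj htors hsha hH2 hP hφ hv₀
  -- Gross–Zagier–Kolyvagin: rank one; `Ш[p^∞]` finite
  obtain ⟨hmw, -⟩ := hGZK W (by rw [hr])
  have hrank : W.mordellWeilRank = 1 := by rw [hmw, hr]
  haveI := hsha
  have hsha' : Finite (AddCommGroup.primaryComponent W.sha p) := inferInstance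
  -- Kato (12.2.1) + Thm. 12.4 (2) on the pin
  obtain ⟨hfg, ⟨htf, hrk⟩, -⟩ := h12 W p κ γ hκ hγ I
  haveI := hfg
  haveI := htf
  haveI : Nontrivial I.H := by
    by_contra hnt
    rw [not_nontrivial_iff_subsingleton] at hnt
    have h0 : Module.rank (IwasawaAlgebra p) I.H = 0 := rank_subsingleton' _ _
    rw [hrk] at h0
    exact one_ne_zero h0
  -- `(J.H2)_Γ` finite; a dual fine Selmer datum of key `γ⁻¹`, finitely generated; J-elimination
  have hfinH2 : Finite (coinvariants p J.H2) := finite_coinvariants_H2_of_iwasawaH2Data W p J hrank hsha'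
  obtain ⟨Y⟩ := W.nonempty_fineSelmerDualData' κ γ⁻¹
  haveI : Module.Finite (IwasawaAlgebra p) Y.X := module_finite_fineSelmerDualData_inv W hγ Y
  obtain ⟨hXinv, hXco, -⟩ := natCard_coinvariants_H2_mul_eq_of_lengthAt_eq W p J Y (hH2 Y) hfinH2
  have hJ := padicValNat_coinvariants_H2_add_eq_of_lengthAt_eq W p J Y (hH2 Y) hfinH2
  have hdesc : Finite I.descentCokernel := J.finite_descentCokernel_iff_finite_coinvariants_H2.mpr hfinH2
  have hfine := hFINE₀ W p κ γ hκ hγ I Y P φ v₀ hr hrank hp2 hadd hj htors hsha hfg htf hrk hdesc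
    inferInstance hXco hXinv hP hφ hv₀
  have hJ' : (padicValNat p (Nat.card (coinvariants p J.H2)) : ℤ) + padicValNat p (Nat.card (invariants p Y.X)) =
      padicValNat p (Nat.card I.descentCokernel) + padicValNat p (Nat.card (coinvariants p Y.X)) := by
    exact_mod_cast hJ
  linarith

/-- **COUNT ⟸ {GZK, `Kato2004.thm12_4`} + COUNT-FINE⁰** (conclusion VERBATIM the display `hCount` of Part 7): Part 11's
`count_of_gzk_of_thm12_4_of_countEC₀` over `countEC₀_of_gzk_of_thm12_4_of_countFine₀`.
[cite: Kato2004Asterisque, §14.9 (14.9.3) (p. 240), §14.14 (p. 243), Lemma 14.15 and Prop. 14.16 (p. 244), Thm. 12.4 (p. 221)]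
[cite: BlochKato1990, Ex. 3.11] [cite: Darmon2004, Thm. 3.22] -/
theorem count_of_gzk_of_thm12_4_of_countFine₀
    (hGZK : rank_eq_analyticRank_of_analyticRank_le_one) (h12 : Kato2004.thm12_4)
    (hFINE₀ : ∀ (W : WeierstrassCurve ℚ) [W.IsElliptic] [W.IsGloballyMinimal] (p : ℕ) [Fact p.Prime],
      letI : ContinuousSMul ℤ_[p] (W.tateModule p) := TateModule.continuousSMul_padicInt
      ∀ (κ : ZpExtension ℚ p) (γ : absoluteGaloisGroup ℚ), κ.IsCyclotomic → κ.IsTopGenerator γ →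
        ∀ (I : IwasawaH1Data W p κ γ) (Y : W.FineSelmerDualData κ γ⁻¹) (P : W.toAffine.Point)
          (φ : integralH1 (tateRep W p) p (κ.layerSubgroup 0) →ₗ[ℤ_[p]] ℚ_[p]) (v₀ : ℤ),
          W.analyticRank = 1 → W.mordellWeilRank = 1 → p ≠ 2 → Addv W p → 0 ≤ padicValRat p W.j →
          ¬ p ∣ W.torsionOrder → Finite W.sha →
          Module.Finite (IwasawaAlgebra p) I.H → Module.IsTorsionFree (IwasawaAlgebra p) I.H →
          Module.rank (IwasawaAlgebra p) I.H = 1 →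
          Finite I.descentCokernel → Module.Finite (IwasawaAlgebra p) Y.X → Finite (coinvariants p Y.X) →
          Finite (invariants p Y.X) →
          (∀ Q : W.toAffine.Point, ∃ n : ℤ, IsOfFinAddOrder (Q - n • P)) →
          (∀ x : integralH1 (tateRep W p) p (κ.layerSubgroup 0),
            HasLocPKummerLog W p (layerZeroToTop W p κ (x : H1 (tateRep W p) (κ.layerSubgroup 0))) (φ x)) →
          LinearMap.range φ = Submodule.span ℤ_[p] {((p : ℚ_[p]) ^ v₀)} →
          (padicValNat p (Nat.card I.descentCokernel) : ℤ) + padicValNat p (Nat.card (coinvariants p Y.X)) -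
              padicValNat p (Nat.card (invariants p Y.X)) + v₀ =
            padicValNat p (Nat.card (AddCommGroup.primaryComponent W.sha p)) + padicValNat p W.tamagawaProduct +
              2 * (padicLogLocal W p
                (WeierstrassCurve.Affine.Point.map (W' := W.toAffine) (S := ℚ) (Algebra.ofId ℚ ℚ_[p]) P)).valuation) :
    ∀ (W : WeierstrassCurve ℚ) [W.IsElliptic] [W.IsGloballyMinimal] (p : ℕ) [Fact p.Prime],
      letI : ContinuousSMul ℤ_[p] (W.tateModule p) := TateModule.continuousSMul_padicInt
      ∀ (κ : ZpExtension ℚ p) (γ : absoluteGaloisGroup ℚ), κ.IsCyclotomic → κ.IsTopGenerator γ →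
        ∀ (I : IwasawaH1Data W p κ γ) (J : IwasawaH2Data W p κ γ I) (x : I.H) (s : ℚ_[p])
          (P : W.toAffine.Point),
          W.analyticRank = 1 → p ≠ 2 → Addv W p → 0 ≤ padicValRat p W.j → ¬ p ∣ W.torsionOrder →
          Finite W.sha →
          (∀ (Y : W.FineSelmerDualData κ γ⁻¹) (𝔮 : PrimeSpectrum (IwasawaAlgebra p)), 𝔮.asIdeal.height = 1 →
            Module.lengthAt (IwasawaAlgebra p) J.H2 𝔮 = Module.lengthAt (IwasawaAlgebra p) Y.X 𝔮) →
          (∀ Q : W.toAffine.Point, ∃ n : ℤ, IsOfFinAddOrder (Q - n • P)) →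
          HasLocPKummerLog W p (layerZeroToTop W p κ (I.proj 0 x)) s →
          (s ≠ 0 ↔ Nat.card (J.A ⧸ (IwasawaAlgebra p) ∙ J.ι (Submodule.Quotient.mk x)) ≠ 0) ∧
            ∀ m : ℕ, Nat.card (J.A ⧸ (IwasawaAlgebra p) ∙ J.ι (Submodule.Quotient.mk x)) =
                p ^ m * Nat.card (coinvariants p J.H2) →
              s.valuation = (m : ℤ) + padicValNat p (Nat.card (AddCommGroup.primaryComponent W.sha p)) +
                padicValNat p W.tamagawaProduct +
                2 * (padicLogLocal W p
                  (WeierstrassCurve.Affine.Point.map (W' := W.toAffine) (S := ℚ) (Algebra.ofId ℚ ℚ_[p]) P)).valuation :=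
  count_of_gzk_of_thm12_4_of_countEC₀ hGZK h12 (countEC₀_of_gzk_of_thm12_4_of_countFine₀ hGZK h12 hFINE₀)

/-- **STUB 3 `stub_rankOneCountReadingKato` from {GZK, `IsNewformOf.level_eq_conductorNorm`, `Kato2004.thm12_4`} + {PR-INV,
COUNT-FINE⁰}** (verbatim the stub's type in both v4 skeletons) — Part 11's `rankOneCountReading_contra_of_gzk_of_thm12_4_of_countEC₀`
with COUNT-EC⁰ supplied by `countEC₀_of_gzk_of_thm12_4_of_countFine₀`. The displayed residual no longer mentions the abstract
module `J.H2` of a package: it is a statement about the pinned `𝐇¹_Γ`, the fine Selmer group `Sel₀(W/ℚ_∞)` and the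
Kummer-log functional. Conditional reduction; closes nothing by itself.
[cite: Kato2004Asterisque, §13.9–13.12 (pp. 229–231), §14.9 (14.9.3) (p. 240), §14.14 (14.14.1) (p. 243), Lemma 14.15 and Prop. 14.16 (p. 244)]
[cite: GreenbergLNM1716, §4 Lemma 4.2 (p. 102)] [cite: BlochKato1990, Def. 3.10 and Ex. 3.11] [cite: BurnsKuriharaSano2019, Thm. 7.3 and Thm. 7.8 (d)]
[cite: Darmon2004, Thm. 3.22] -/
theorem rankOneCountReading_contra_of_gzk_of_thm12_4_of_countFine₀
    (hGZK : rank_eq_analyticRank_of_analyticRank_le_one)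
    (hlev : ∀ (N : ℕ) [NeZero N], IsNewformOf.level_eq_conductorNorm (N := N))
    (h12 : Kato2004.thm12_4)
    (hPRinv : ∀ (W : WeierstrassCurve ℚ) [W.IsElliptic] [W.IsGloballyMinimal] (p : ℕ) [Fact p.Prime]
      (ℒ₁ ℒ₂ : ℚ_[p]), Kato2004.PRRatio W p ℒ₁ → Kato2004.PRRatio W p ℒ₂ → ∃ w : ℚ_[p], ‖w‖ = 1 ∧ ℒ₂ = w * ℒ₁)
    (hFINE₀ : ∀ (W : WeierstrassCurve ℚ) [W.IsElliptic] [W.IsGloballyMinimal] (p : ℕ) [Fact p.Prime],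
      letI : ContinuousSMul ℤ_[p] (W.tateModule p) := TateModule.continuousSMul_padicInt
      ∀ (κ : ZpExtension ℚ p) (γ : absoluteGaloisGroup ℚ), κ.IsCyclotomic → κ.IsTopGenerator γ →
        ∀ (I : IwasawaH1Data W p κ γ) (Y : W.FineSelmerDualData κ γ⁻¹) (P : W.toAffine.Point)
          (φ : integralH1 (tateRep W p) p (κ.layerSubgroup 0) →ₗ[ℤ_[p]] ℚ_[p]) (v₀ : ℤ),
          W.analyticRank = 1 → W.mordellWeilRank = 1 → p ≠ 2 → Addv W p → 0 ≤ padicValRat p W.j →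
          ¬ p ∣ W.torsionOrder → Finite W.sha →
          Module.Finite (IwasawaAlgebra p) I.H → Module.IsTorsionFree (IwasawaAlgebra p) I.H →
          Module.rank (IwasawaAlgebra p) I.H = 1 →
          Finite I.descentCokernel → Module.Finite (IwasawaAlgebra p) Y.X → Finite (coinvariants p Y.X) →
          Finite (invariants p Y.X) →
          (∀ Q : W.toAffine.Point, ∃ n : ℤ, IsOfFinAddOrder (Q - n • P)) →
          (∀ x : integralH1 (tateRep W p) p (κ.layerSubgroup 0),
            HasLocPKummerLog W p (layerZeroToTop W p κ (x : H1 (tateRep W p) (κ.layerSubgroup 0))) (φ x)) →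
          LinearMap.range φ = Submodule.span ℤ_[p] {((p : ℚ_[p]) ^ v₀)} →
          (padicValNat p (Nat.card I.descentCokernel) : ℤ) + padicValNat p (Nat.card (coinvariants p Y.X)) -
              padicValNat p (Nat.card (invariants p Y.X)) + v₀ =
            padicValNat p (Nat.card (AddCommGroup.primaryComponent W.sha p)) + padicValNat p W.tamagawaProduct +
              2 * (padicLogLocal W p
                (WeierstrassCurve.Affine.Point.map (W' := W.toAffine) (S := ℚ) (Algebra.ofId ℚ ℚ_[p]) P)).valuation) :
    TorsionFree.RankOneCountReading IsKatoZetaDescentDatumOfContra Kato2004.PRRatio :=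
  rankOneCountReading_contra_of_gzk_of_thm12_4_of_countEC₀ hGZK hlev h12 hPRinv
    (countEC₀_of_gzk_of_thm12_4_of_countFine₀ hGZK h12 hFINE₀)

end CountFine

end Summit.BirchSwinnertonDyer.Rank1Residual.Additive.LocPKummer

end
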